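import Summits.BirchSwinnertonDyer.Rank1Residual.O5.HeegnerLogTransportThree
import Summits.BirchSwinnertonDyer.Rank1Residual.O5.NoLocalThreeTorsionTransport
import Summits.BirchSwinnertonDyer.Rank1Residual.X11b.AnticyclotomicGoodPlaces
import Summits.BirchSwinnertonDyer.Rank1Residual.X11b.AnticyclotomicLocalTorsionDescent
import Summits.BirchSwinnertonDyer.Rank1Residual.X11b.AnticyclotomicLocalKernelTrivial
import Summits.BirchSwinnertonDyer.Rank1Residual.X11b.AnticyclotomicInfinitePlaces
import Summits.BirchSwinnertonDyer.Rank1Residual.X11b.AnticyclotomicSelmerStructure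
import Summits.BirchSwinnertonDyer.Rank1Residual.X11b.BDPRouteControlStrictPlace
import Summits.BirchSwinnertonDyer.Rank1Residual.X11b.AnticyclotomicControlSplitImprimitive
import Summits.BirchSwinnertonDyer.Rank1Residual.X11b.AnticyclotomicControlAtoms
import Summits.BirchSwinnertonDyer.Rank1Residual.X11b.CongruentTransferPotGoodAbove
import Literature.NumberTheory.EllipticCurves.SelmerInftyTorsionFiniteProofs
import Literature.NumberTheory.EllipticCurves.SelmerRestrictionCorank
import Literature.NumberTheory.EllipticCurves.IwasawaTowerTorsionProofs
import Literature.NumberTheory.EllipticCurves.DiscreteH1Equiv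
import Literature.NumberTheory.EllipticCurves.PointDivisibilityProofs
import HarnessLib
import HarnessLib.Audit.Tags

/-!
# Heegner-log transport at `p = 3` (KL3), part 7: KL3-M (`ResidualSelmerMatchingThree`) at a DEGREE-ONE `𝔭` is a THEOREM —
# the residual transport of `#Sel_𝔭(K, E[3^∞]) = 1` along `W[3] ≃ G[3]` — o5-r2 GEN 20

HONEST FRAMING (cell `b2b-bsdres`, run/shared/lean/b2b/bsd-rank1-residual/, verbatim in every file): the
goal of the cell is to DELETE the COMBINATION-SHAPED residual classes of the Birch–Swinnerton-Dyer formula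
for ALL analytic-rank `≤ 1` elliptic curves over `ℚ` — "full BSD formula for every rank `≤ 1` curve in
class `C`" assembled STRICTLY from published theorems — so that the rank-`≤ 1` remainder becomes exactly
the CONSTRUCTION-SHAPED classes, which are TYPED (missing-input `Prop`s), NOT attempted. This is not
"finishing BSD". Team O5 (tame potentially supersingular additive `p = 3`, (t′)), planner o5-r2 (the
non-Iwasawa side), GEN 20; RESEARCH ROUTE; THEOREMS over explicit hypotheses: no new node is WANTED, no
Literature fact, no `@[conjecture]`, no new object (one `def … : Prop` naming the proved statement KL3-M°,
proved in this file; one `abbrev` for `θ_* = h1Equiv θ`); NOTHING is booked and no mark of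
`RESIDUAL-MAP.md` moves. O5 OPEN.

## What this file proves (GEN 19 docket (b); memo `HOME/b2b-bsdres-o5-r2/gen20/O5-GEN20.md`)

KL3-M (`ResidualSelmerMatchingThree`, part 1 `O5/HeegnerLogTransportThree.lean` §KL3-M) was the typed node
"for a mod-`3` congruent pair `(W, G)` (`ρ̄_{W,3}` onto, `W(ℚ₃)[3] = 0`, `W(ℚ_ℓ)[3] = 0` at the bad
`ℓ ≠ 3`), an imaginary quadratic `K` Heegner for `N_W N_G` and a prime `𝔭 ∣ 3` of `K`:
`#Sel_𝔭(K, W[3^∞]) = 1 ↔ #Sel_𝔭(K, G[3^∞]) = 1`" (`Sel_𝔭 = selmerAcBase · 3 𝔭 ∅`: unramified away from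
`𝔭`, STRICT at `𝔭`, vacuous at the complex place). THIS FILE PROVES IT at every `𝔭` of DEGREE ONE
(`e(𝔭|3) = f(𝔭|3) = 1` — the binders `he`, `hf` that every END of the chain already holds for `embAt 𝔭`;
automatic when `3 ∣ N_W N_G`, e.g. on every O5 row, where `W` is additive at `3`:
`natCard_selmerAcBase_eq_one_iff_companion_of_three_dvd`):

* **KL3-M° `residualSelmerMatchingThreeDegOne_holds : ResidualSelmerMatchingThreeDegOne`** (§6).

The mechanism is the RESIDUAL TRANSPORT of a strict `p^∞`-Selmer group of ORDER ONE along a Galois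
isomorphism of `p`-torsion, for elliptic curves `X`, `Y` over any totally complex number field `K` (§5,
`natCard_selmerAcBase_eq_one_iff_of_torsionEquiv`, symmetric hypotheses):
1. `#Sel = 1 ↔ Sel[p] = 0` (`Sel ⊆ H¹(K, E[p^∞])` is `p`-power torsion: `Γ_K` compact; §5).
2. A class `c ∈ Sel_𝔭(K, X[p^∞])[p]` lifts to `y ∈ H¹(K, X[p])` (Kummer, `exists_torsionToPrimaryH1Sub_eq`,
   `X(K̄)` `p`-divisible); put `y′ = θ_* y ∈ H¹(K, Y[p])`, `c′ = ι_* y′ ∈ H¹(K, Y[p^∞])`.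
3. LOCAL TRANSPORT (§4): at a finite `v ∤ p` where BOTH curves have good reduction, restrict to the inertia
   group `I_v`, which acts trivially on `X[p^∞]` and `Y[p^∞]` (Néron–Ogg–Shafarevich, Silverman VII.4.1):
   `res_{I_v} c = 0 ⟹ res_{I_v} y = 0` (`ι_*` injective on `H¹(I_v, ·)` for a trivial action) `⟹
   res_{I_v} y′ = 0 ⟹ res_{I_v} c′ = 0 ⟹ res_{D_v} c′ = 0` by Greenberg's Lemma 3.3
   (`H¹(G_v/I_v, Y[p^∞]^{I_v}) = 0`, tree `resOfLe_inertia_top_inf_injective_of_hasGoodReductionAt`); at a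
   finite `v` (the place `𝔭`, or a bad `v ∤ p`) where `X[p^∞]^{D_v}[p] = 0`: `ι_*` is injective on
   `H¹(D_v, X[p])`, so `res_{D_v} c = 0 ⟹ res_{D_v} y = 0 ⟹ res_{D_v} y′ = 0 ⟹ res_{D_v} c′ = 0`; the
   strict condition at `𝔭` IS the away condition (`mem_strictKer_strictDatum_iff_mem_awayKer`); complex
   places are vacuous (§3).
4. So `c′ ∈ Sel_𝔭(K, Y[p^∞]) = 0`, hence `y′ = 0` (`ι_*` injective on `H¹(K, Y[p])` since
   `Y(K)[p] ⊆ Y[p^∞]^{D_𝔭}[p] = 0`), `y = 0`, `c = 0`.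
For the pair `(W_K, G_K)`, `p = 3` (§6): `θ` is the `Γ_ℚ`-equivariant `W[3] ≃ G[3]` of a surjective mod-3
congruence (Brauer–Nesbitt + Chebotarev, tree `exists_addEquiv_geomTorsion_of_isCongruentModThree'`,
Darmon–Diamond–Taylor Prop. 2.6 (b)) base-changed to `Γ_K` (`baseChangeTorsionEquiv`); the descent datum
`E_K[3^∞]^{D_v}[3] = 0` comes from `E(ℚ_ℓ)[3] = 0` whenever `K_v → ℚ_ℓ` (`eq_zero_of_fixed_decomp_of_local`,
`noPTorsion_baseChange_adicCompletion_of_ringHom`), i.e. whenever `v` has degree one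
(`exists_ringHom_adicCompletion_padic_of_degreeOne`): at `𝔭` by `he`, `hf`; at a bad `v ∤ 3` because the
prime `ℓ` below `v` divides `N_W N_G` (`primesEquiv_under_dvd_conductorNorm_of_not_hasGoodReductionAt`),
hence SPLITS in `K` by the Heegner hypothesis (`splitsIn_primesEquiv_under_iff`); and `G(ℚ_ℓ)[3] = 0`
follows from `W(ℚ_ℓ)[3] = 0` along the congruence (`noLocalThreeTorsionAt_of_isCongruentModThree`, GEN 17).

WHY NOT KL3-M AS TYPED (no degree-one binder): when `3 ∤ N_W N_G` and `3` is inert or ramified in `K`,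
`K_𝔭 ≠ ℚ₃` and `W(ℚ₃)[3] = 0` does not give `W(K_𝔭)[3] = 0`; the local Kummer images
`W(K_𝔭)[3^∞]/3`, `G(K_𝔭)[3^∞]/3` need not correspond under `θ`, so residual matching does not decide
the binder-free statement there. That regime is OFF the O5 population (`W` additive at `3 ⟹ 3 ∣ N_W ⟹ 3`
splits in `K`) and off every END (all hold `he`, `hf`). `residualSelmerMatchingThreeDegOne_of` records
KL3-M ⟹ KL3-M°. The END file `O5/HeegnerLogTransportThreeResidualEnd.lean` (same generation) deletes the
binder `hM` from the three KL3-C♭ assemblies.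

NET for the KL3 chain (memo §3): KL3-M is no longer an input of any END; remaining typed inputs KL3-A
(print), KL3-B, KL3-G (print), STEP-0. O5 OPEN; nothing booked; the census (`HOME/census/`) is EVIDENCE,
never a Literature fact.

References: [cite: GreenbergLNM1716, §2 (pp. 62–64), §3 Lemma 3.3 (p. 87), §5 p. 114];
[cite: Castella2018, Def. 2.2 (arXiv:1704.06608 p. 5)]; [cite: Castella2018Erratum, Thm. 1.1 (iv) (p. 1)];
[cite: DarmonDiamondTaylor1995, Prop. 2.6 (b) (PDF p. 53)]; [cite: SilvermanAEC2009, Prop. VII.4.1(a), VIII.§1–2];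
[cite: KrizLi2019, Thm. 1.16, Rem. 1.17] (the consumer). Serre, *Galois Cohomology*, I.§2.4, I.§5.1 (generic §1).

## TYPER PLACEMENT NOTE

New file `O5/HeegnerLogTransportThreeResidual.lean` (part 7), imports only tree modules (parts 1, GEN 17's
`NoLocalThreeTorsionTransport`, the X11b anticyclotomic-Selmer API, Literature Selmer/H¹ proofs); place
BEFORE `O5/HeegnerLogTransportThreeResidualEnd.lean`, which imports it. `lean check` rc 0, 0 sorries,
0 warnings; axioms of `residualSelmerMatchingThreeDegOne_holds`: `propext, Classical.choice, Quot.sound`.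

## TYPER PLACEMENT NOTE (cc-typer-5 GEN 18 = O5 §3.5 / O6 §3.4 typer of record; by-name ask A-O5-G20-1 of o5-r2 GEN 20, HOME/INBOX.md l.13845:
'place by sha, the same way as A-O5-G18-1 / A-O5-G19-1, TWO files IN ORDER … over 400 l. — if your lane splits …')

Source (i): `HOME/b2b-bsdres-o5-r2/gen20/lean/HeegnerLogTransportThreeResidual.lean` sha16 `85675e73a855d4e1` (634 l.; o5-r2 GEN 20's file (i), standalone `lean check` rc 0 / 0 warnings ×4 per l.13845),
re-hashed by the typer right before writing.  634 l. > `lint.size` 400 and §1–§5 + the module text alone are 484 l., so the typer's cut is at the §3/§4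
SECTION BOUNDARY (every `section … end` with its `variable`s stays whole): `O5/HeegnerLogTransportThreeResidualEngine.lean` = the source's imports + module
text VERBATIM (incl. the planner's own placement note above) + preamble + §1 generic H¹ lemmas + §2 Kummer comparison + §3 infinite places;
`O5/HeegnerLogTransportThreeResidual.lean` = preamble + §4 transport of the local conditions + §5 the symmetric Selmer statement + §6 KL3-M° `ResidualSelmerMatchingThreeDegOne`
and its PROOF `residualSelmerMatchingThreeDegOne_holds` — this second file keeps the source's MODULE NAME so that file (ii)
`O5/HeegnerLogTransportThreeResidualEnd.lean` imports it verbatim.  Every declaration block is byte-identical to the source and in source order (script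
`class-closure/typer-5/gen18/g20_place.py` asserts §1–§3 ++ §4–§6 == source §1..`end`); farm: Engine standalone and Engine+Residual(+End) joint rc 0 / 0 warnings,
axioms of `residualSelmerMatchingThreeDegOne_holds` / `natCard_selmerAcBase_eq_one_iff_of_torsionEquiv` / `o5_index_unit_of_ordinary_companion_residual` {propext,
Classical.choice, Quot.sound}; DEDUP `lean search --decl` on the 24 new names: no match.  CONTENT LABELS (source, unchanged): THEOREMS + ONE `def
ResidualSelmerMatchingThreeDegOne : Prop` (KL3-M°, PROVED in the same file — a proved helper, not a node, not a fact) + ONE `abbrev torsionH1Map`; 0 `@[conjecture]`;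
0 Literature facts (net named-fact debt 0); no `sorry`.  THIS file = part (i), §1–§3.
KL3 parts 1–6: `O5/HeegnerLogTransportThree{,Chain,Targets,Global}.lean` (p340741 / p341262 / p341640 / p342632), `…OrdCompanion{,Index}.lean` (p343587 / p344465),
`…OrdSelmer{,Index}.lean` (p345030 / p345686), `…OrdTwist.lean` (p346273); Literature index lemma p344022.  HONEST FRAMING (cell `b2b-bsdres`): research route, lane
CLASS-CLOSURE §3.5 O5; nothing asserted beyond the displayed binders, nothing booked, no mark of `RESIDUAL-MAP.md` moves; census = EVIDENCE, never a Literature fact; O5 OPEN.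
-/

set_option autoImplicit false

open scoped Classical

open NumberField IsDedekindDomain Field IsDedekindDomain.HeightOneSpectrum
open WeierstrassCurve
open Literature.NumberTheory.EllipticCurves Literature.NumberTheory.EllipticCurves.GreenbergSelmer
open Literature.NumberTheory.GaloisRepresentations

noncomputable section

namespace Summit.BirchSwinnertonDyer.Rank1Residual.O5.HeegnerLogTransport

open Summit.BirchSwinnertonDyer.Rank1Residual.X11b Summit.BirchSwinnertonDyer.Rank1Residual.X11b.AcSelmer
open Summit.BirchSwinnertonDyer.Rank1Residual.X11b.CongruentTransfer (baseChangeTorsionEquiv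
  baseChangeTorsionEquiv_smul)

/-! ## §1 Generic cohomological lemmas -/

section Generic

variable {G : Type} [Group G] [TopologicalSpace G] [IsTopologicalGroup G]
variable {M : Type} [AddCommGroup M] [DistribMulAction G M] [TopologicalSpace M] [DiscreteTopology M]
variable {M' : Type} [AddCommGroup M'] [DistribMulAction G M'] [TopologicalSpace M']
  [DiscreteTopology M']

/-- `H¹(H, M) = 0` for the trivial subgroup `H` (a crossed homomorphism vanishes at `1`).
Serre, *Galois Cohomology*, I.§5.1. [folklore] -/
theorem subgroupH1_eq_zero_of_forall_eq_one {H : Subgroup G} (hH : ∀ σ ∈ H, σ = 1)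
    (x : subgroupH1 H M) : x = 0 := by
  obtain ⟨φ, rfl⟩ := oneCocycleClass_surjective _ x
  have h1 : ∀ σ : H, σ = 1 := fun σ ↦ Subtype.ext (hH σ.1 σ.2)
  have hφ : φ = 0 := by
    apply Subtype.ext
    ext σ
    rw [h1 σ]
    exact contOneCocycles.apply_one φ
  rw [hφ]
  exact oneCocycleClass_zero _

/-- `res_{H ≤ H'} [f] = [f ∘ incl]` on explicit cocycles (`map_oneCocycleClass`). [folklore] -/
theorem resOfLe_oneCocycleClass_eq {H H' : Subgroup G} (h : H ≤ H')
    (f : contOneCocycles (discreteTopRep H' M)) :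
    resOfLe M h (oneCocycleClass _ f) =
      oneCocycleClass (discreteTopRep H M)
        (contOneCocycles.pullback (subgroupInclusion h)
          (resHomOfEquivariant (subgroupInclusion h) (AddMonoidHom.id M) fun _ _ ↦ rfl) f) :=
  map_oneCocycleClass _ _ _ f

/-- **Restriction commutes with the transport of coefficients**: for a `G`-equivariant
`θ : M ≃+ M'` and subgroups `H ≤ H'`, `res_{H ≤ H'} (θ_* c) = 0 ↔ res_{H ≤ H'} c = 0`
(`mem_resKer_iff_h1Equiv_mem` for the pairs `(incl, id_M)`, `(incl, id_{M'})` intertwined by `θ`).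
Serre, *Galois Cohomology*, I.§2.4. [folklore] -/
theorem resOfLe_h1Equiv_eq_zero_iff {H H' : Subgroup G} (h : H ≤ H') (θ : M ≃+ M')
    (hθ : ∀ (g : G) (m : M), θ (g • m) = g • θ m) (c : subgroupH1 H' M) :
    resOfLe M' h (h1Equiv θ (fun (g : H') m ↦ hθ g m) c) = 0 ↔ resOfLe M h c = 0 := by
  have key := mem_resKer_iff_h1Equiv_mem (subgroupInclusion h) (AddMonoidHom.id M)
    (fun _ _ ↦ rfl) (AddMonoidHom.id M') (fun _ _ ↦ rfl) θ (fun (g : H') m ↦ hθ g m) θ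
    (fun (x : H) n ↦ hθ x n) (fun _ ↦ rfl) c
  rw [resKer_eq_ker, resKer_eq_ker, AddMonoidHom.mem_ker, AddMonoidHom.mem_ker] at key
  exact key.symm

/-- **A `p`-primary group is trivial iff it has no `p`-torsion.** [folklore] -/
theorem natCard_eq_one_iff_forall_nsmul {A : Type} [AddCommGroup A] {p : ℕ}
    (hA : ∀ a : A, ∃ k : ℕ, p ^ k • a = 0) :
    Nat.card A = 1 ↔ ∀ a : A, p • a = 0 → a = 0 := by
  constructor
  · intro h a _
    haveI := (Nat.card_eq_one_iff_unique.mp h).1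
    exact Subsingleton.elim a 0
  · intro h
    have h0 : ∀ a : A, a = 0 := by
      intro a
      obtain ⟨k, hk⟩ := hA a
      induction k generalizing a with
      | zero => simpa using hk
      | succ k ih =>
        apply ih
        apply h
        rw [smul_smul, ← pow_succ']
        exact hk
    haveI : Subsingleton A := ⟨fun a b ↦ by rw [h0 a, h0 b]⟩
    exact Nat.card_eq_one_iff_unique.mpr ⟨inferInstance, ⟨0⟩⟩

end Generic

/-! ## §2 The Kummer comparison `ι_* : H¹(H, E[p]) → H¹(H, E[p^∞])` at an arbitrary level `H ≤ Γ_K` -/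

section Kummer

variable {K : Type} [Field K] (X : WeierstrassCurve K) (p : ℕ) [Fact p.Prime]

omit [Fact p.Prime] in
/-- **`ι_*` is injective when `E[p^∞]^H` has no `p`-torsion** (`H ≤ Γ_K` arbitrary): if
`[ι ∘ φ] = 0`, `ι(φ σ) = σ a − a`, then `p a` is `H`-fixed, hence `0` (an `H`-fixed element of the
`p`-primary `E[p^∞]` has a non-zero multiple killed by `p` unless it is `0`), so `a ∈ E[p]` and
`φ = ∂a` in `E[p]`. The tree's `torsionToPrimaryH1_injective_of_no_pTorsion` is the case `H = Γ_K`
with `E(K)[p] = 0`. [cite: GreenbergLNM1716, §5 p. 114 (proof of Prop. 5.8)] -/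
theorem torsionToPrimaryH1Sub_injective_of_fixed (H : Subgroup (absoluteGaloisGroup K))
    (hH : ∀ m : X.geomPrimaryTorsion p, (∀ σ ∈ H, σ • m = m) → p • m = 0 → m = 0) :
    Function.Injective (X.torsionToPrimaryH1Sub p H) := by
  -- every `H`-fixed element of `E[p^∞]` vanishes
  have hfix : ∀ m : X.geomPrimaryTorsion p, (∀ σ ∈ H, σ • m = m) → m = 0 := by
    intro m hm
    by_contra h0
    obtain ⟨j, hne, hpj⟩ := X.exists_pow_smul_ne_zero_and_p_smul_eq_zero h0
    exact hne (hH _ (fun σ hσ ↦ by rw [smul_comm, hm σ hσ]) hpj)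
  rw [injective_iff_map_eq_zero]
  intro y hy
  obtain ⟨φ, rfl⟩ := oneCocycleClass_surjective _ y
  rw [WeierstrassCurve.torsionToPrimaryH1Sub_oneCocycleClass, oneCocycleClass_eq_zero_iff] at hy
  obtain ⟨a, ha⟩ := hy
  have ha' : ∀ σ : H,
      AddSubgroup.inclusion (geomTorsion_le_geomPrimaryTorsion X p) (φ.1 σ) =
        (σ : absoluteGaloisGroup K) • a - a := fun σ ↦ ha σ
  have hval : ∀ σ : H, p • φ.1 σ = 0 := fun σ ↦ by
    apply Subtype.ext
    rw [AddSubgroupClass.coe_nsmul, ZeroMemClass.coe_zero]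
    exact AddSubgroup.torsionBy.nsmul_iff.mp (φ.1 σ).2
  -- `p • a` is `H`-fixed, hence zero
  have hpa : ∀ σ ∈ H, σ • (p • a) = p • a := fun σ hσ ↦ by
    rw [← sub_eq_zero, smul_comm, ← smul_sub, ← ha' ⟨σ, hσ⟩, ← map_nsmul, hval, map_zero]
  have hpa0 : p • a = 0 := hfix _ hpa
  have hamem : ((a : X.geomPrimaryTorsion p) : geomPoints X) ∈ geomTorsion X (p : ℤ) :=
    AddSubgroup.torsionBy.nsmul_iff.mpr (by
      rw [← AddSubgroupClass.coe_nsmul, hpa0, ZeroMemClass.coe_zero])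
  refine (oneCocycleClass_eq_zero_iff _ φ).mpr ⟨⟨_, hamem⟩, fun σ ↦ ?_⟩
  apply AddSubgroup.inclusion_injective (geomTorsion_le_geomPrimaryTorsion X p)
  rw [ha', map_sub]
  rfl

omit [Fact p.Prime] in
/-- **`ι_*` is injective when `H` acts trivially on `E[p^∞]`** (e.g. `H` an inertia group at a good
place `v ∤ p`): a principal crossed homomorphism `σ ↦ σ a − a` of a trivial module is `0`.
Serre, *Galois Cohomology*, I.§5.1. [folklore] -/
theorem torsionToPrimaryH1Sub_injective_of_trivial (H : Subgroup (absoluteGaloisGroup K))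
    (hH : ∀ σ ∈ H, ∀ m : X.geomPrimaryTorsion p, σ • m = m) :
    Function.Injective (X.torsionToPrimaryH1Sub p H) := by
  rw [injective_iff_map_eq_zero]
  intro y hy
  obtain ⟨φ, rfl⟩ := oneCocycleClass_surjective _ y
  rw [WeierstrassCurve.torsionToPrimaryH1Sub_oneCocycleClass, oneCocycleClass_eq_zero_iff] at hy
  obtain ⟨a, ha⟩ := hy
  have ha' : ∀ σ : H,
      AddSubgroup.inclusion (geomTorsion_le_geomPrimaryTorsion X p) (φ.1 σ) =
        (σ : absoluteGaloisGroup K) • a - a := fun σ ↦ ha σ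
  have h0 : ∀ σ : H, φ.1 σ = 0 := fun σ ↦ by
    apply AddSubgroup.inclusion_injective (geomTorsion_le_geomPrimaryTorsion X p)
    rw [ha', map_zero, hH σ.1 σ.2, sub_self]
  have hφ : φ = 0 := by
    apply Subtype.ext
    ext σ
    rw [h0]
    rfl
  rw [hφ]
  exact oneCocycleClass_zero _

omit [Fact p.Prime] in
/-- **`ι_*` commutes with restriction**: `res_{H ≤ H'} (ι_* y) = ι_* (res_{H ≤ H'} y)` (both are
`[ι ∘ f ∘ incl]` on cocycles). Serre, *Galois Cohomology*, I.§2.4. [folklore] -/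
theorem resOfLe_torsionToPrimaryH1Sub {H H' : Subgroup (absoluteGaloisGroup K)} (h : H ≤ H')
    (y : subgroupH1 H' (geomTorsion X (p : ℤ))) :
    resOfLe (X.geomPrimaryTorsion p) h (X.torsionToPrimaryH1Sub p H' y) =
      X.torsionToPrimaryH1Sub p H (resOfLe (geomTorsion X (p : ℤ)) h y) := by
  obtain ⟨f, rfl⟩ := oneCocycleClass_surjective _ y
  rw [WeierstrassCurve.torsionToPrimaryH1Sub_oneCocycleClass, resOfLe_oneCocycleClass_eq,
    resOfLe_oneCocycleClass_eq, WeierstrassCurve.torsionToPrimaryH1Sub_oneCocycleClass]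
  rfl

end Kummer

/-! ## §3 Vacuous infinite conditions for totally complex `K` -/

section Infinite

variable {K : Type} [Field K] [NumberField K]
variable {M : Type} [AddCommGroup M] [DistribMulAction (absoluteGaloisGroup K) M] [TopologicalSpace M]
  [DiscreteTopology M]

/-- **For totally complex `K` every class of `H¹(K, M)` satisfies the infinite conditions**:
`D_w = ⊥` at a complex place (`decompInf_eq_bot_of_isComplex`), and `H¹(⊥, M) = 0`.
[cite: GreenbergLNM1716, §3 p. 87 (archimedean primes split completely)] -/
theorem mem_infKer_top_of_isTotallyComplex [IsTotallyComplex K] (w : InfinitePlace K)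
    (c : subgroupH1 (⊤ : Subgroup (absoluteGaloisGroup K)) M) : c ∈ infKer ⊤ M w := by
  rw [infKer, AddMonoidHom.mem_ker]
  refine subgroupH1_eq_zero_of_forall_eq_one (fun σ hσ ↦ ?_) _
  have hD : σ ∈ decompInf w := (Subgroup.mem_inf.mp hσ).2
  rw [decompInf_eq_bot_of_isComplex (IsTotallyComplex.isComplex w)] at hD
  exact Subgroup.mem_bot.mp hD

end Infinite

end Summit.BirchSwinnertonDyer.Rank1Residual.O5.HeegnerLogTransport

end
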